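import Literature.NumberTheory.GaloisRepresentations.ContinuousCohomologyTowerLimitInjective
import Literature.NumberTheory.GaloisRepresentations.LocalOneUnitsProofs
import Mathlib.NumberTheory.Padics.RingHoms
import HarnessLib

/-!
# `H²_cont(G, ℚ_l) = 0` from uniform torsion of the `H²(G, ℤ/lⁱ)`: the `ℤ_l`-tower and `ℚ_l`-coefficients

Topic `NumberTheory/GaloisRepresentations` (continuous cohomology of profinite groups with `l`-adic
coefficients).  Theorems and auxiliary definitions with bodies only (no named fact).

For a compact (locally compact) topological group `G` and a prime `l` we prove the classical passage
from finite to `l`-adic to rational `l`-adic coefficients in degree `2`, for the TRIVIAL action: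

* `padicIntTower G l` — the trivial representation `ℤ_l` presented as the inverse limit of the
  `ℕ`-tower of trivial discrete representations `ℤ/lⁱ` (projections `PadicInt.toZModPow`, transition
  maps `ZMod.castHom`, lifting of compatible families by `PadicInt.lift`), an instance of the tree's
  `DiscreteTowerPresentation` (Neukirch–Schmidt–Wingberg (2.7.5), `ContinuousCohomologyTowerLimit*`);
* `twoCocycleClass_padicInt_torsion_of_forall_zmod` — if one integer `m ≥ 1` kills `H²(G, ℤ/lⁱ)`
  for every `i`, and the `H¹(G, ℤ/lⁱ)` are finite, then `m` kills `H²_cont(G, ℤ_l)` (injectivity of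
  `H²(G, lim ℤ/lⁱ) → lim H²(G, ℤ/lⁱ)`, Mittag-Leffler);
* `subsingleton_continuousCohomology_two_padic_of_forall_zmod` — under the same hypotheses
  **`H²_cont(G, ℚ_l) = 0`** for Mathlib's `continuousCohomology` of the trivial representation on
  `ULift ℚ_l` (the coefficient object of the [AbsTopI] invariant `δ²_l`,
  `Literature.AnabelianGeometry.AbsoluteAnabelian.deltaInv`): a continuous `ℚ_l`-valued `2`-cocycle on
  the compact `G × G` is bounded, `l^N` times it is `ℤ_l`-valued, `m` times that is the coboundary of a
  continuous `ℤ_l`-valued cochain, and one divides by `m l^N` in `ℚ_l`.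

This is the mechanism behind "`δ²_l(G) = 0` [cf., e.g., [NSW], Theorem 7.2.6]" in the proof of
[AbsTopI] Thm 2.6 (iii) (S. Mochizuki, *Topics in Absolute Anabelian Geometry I*, p. 23): the rational
`l`-adic `H²` of a profinite group vanishes as soon as the finite-level `H²(−, ℤ/lⁱ)` have bounded
exponent.  Classical, undisputed; nothing here bears on [IUTchIII] Cor. 3.12.

## References
* J. Neukirch, A. Schmidt, K. Wingberg, *Cohomology of Number Fields*, 2nd ed. (2008), (2.7.5),
  (2.7.6), (2.3.4)–(2.3.5). [NeukirchSchmidtWingberg2008]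
* J. Tate, *Relations between K₂ and Galois cohomology*, Invent. Math. 36 (1976), §2 (continuous
  cochain cohomology with `ℤ_l`- and `ℚ_l`-coefficients). [Tate1976K2]
* S. Mochizuki, *Topics in Absolute Anabelian Geometry I: Generalities*, J. Math. Sci. Univ. Tokyo 19
  (2012), Thm 2.6 (iii) and its proof p. 23. [MochizukiAbsTopI2012]
-/

noncomputable section

open CategoryTheory Function Topology

namespace Literature.NumberTheory.GaloisRepresentations

open _root_.TopRep _root_.ContRepresentation _root_.ContinuousCohomology

/-! ### The `ℤ_l`-tower: `ℤ_l = lim ℤ/lⁱ` with trivial action -/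

section Tower

variable (G : Type) [Group G] [TopologicalSpace G] [IsTopologicalGroup G]
variable (l : ℕ)

/-- The trivial (discrete) topological representation of `G` on `ℤ/lⁱ`, over `ℤ`.
[cite: NeukirchSchmidtWingberg2008, II §7 (2.7.5)] -/
abbrev zmodRep (i : ℕ) : TopRep.{0} ℤ G := (ContinuousRep.trivial G ℤ (ZMod (l ^ i))).toTopRep

/-- The transition map `ℤ/l^{i+1} → ℤ/lⁱ` as a morphism of (trivial) topological representations.
[cite: NeukirchSchmidtWingberg2008, II §7 (2.7.5)] -/
def zmodTr (i : ℕ) : zmodRep G l (i + 1) ⟶ zmodRep G l i :=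
  TopRep.ofHom
    ⟨{ toLinearMap := (ZMod.castHom (pow_dvd_pow l (Nat.le_succ i)) (ZMod (l ^ i))).toIntLinearMap
       cont := continuous_of_discreteTopology }, fun _ => rfl⟩

omit [IsTopologicalGroup G] in
/-- Unfolding `zmodTr` (transition map of the tower of [NSW] (2.7.5)). [cite: NeukirchSchmidtWingberg2008, II §7 (2.7.5)] -/
@[simp] theorem zmodTr_hom_apply (i : ℕ) (x : ZMod (l ^ (i + 1))) :
    (zmodTr G l i).hom x = ZMod.castHom (pow_dvd_pow l (Nat.le_succ i)) (ZMod (l ^ i)) x := rfl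

variable [Fact l.Prime]

/-- The trivial topological representation of `G` on `ℤ_l` (`l`-adic topology), over `ℤ`.
[cite: NeukirchSchmidtWingberg2008, II §7 (2.7.5)] -/
abbrev padicIntRep : TopRep.{0} ℤ G := (ContinuousRep.trivial G ℤ ℤ_[l]).toTopRep

/-- The projection `ℤ_l → ℤ/lⁱ` (`PadicInt.toZModPow`) as a morphism of (trivial) topological
representations. [cite: NeukirchSchmidtWingberg2008, II §7 (2.7.5)] -/
def padicProj (i : ℕ) : padicIntRep G l ⟶ zmodRep G l i :=
  TopRep.ofHom
    ⟨{ toLinearMap := (PadicInt.toZModPow i : ℤ_[l] →+* ZMod (l ^ i)).toIntLinearMap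
       cont := OneUnits.continuous_toZModPow l i }, fun _ => rfl⟩

omit [IsTopologicalGroup G] in
/-- Unfolding `padicProj` (projection of the tower of [NSW] (2.7.5)). [cite: NeukirchSchmidtWingberg2008, II §7 (2.7.5)] -/
@[simp] theorem padicProj_hom_apply (i : ℕ) (x : ℤ_[l]) :
    (padicProj G l i).hom x = PadicInt.toZModPow i x := rfl

/-- The subring of compatible sequences in `∏ᵢ ℤ/lⁱ` (the set-theoretic inverse limit), used to lift
compatible families to `ℤ_l` through `PadicInt.lift`. [cite: NeukirchSchmidtWingberg2008, II §7 (2.7.5)] -/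
def compatSeq : Subring (∀ i : ℕ, ZMod (l ^ i)) where
  carrier := {s | ∀ i, ZMod.castHom (pow_dvd_pow l (Nat.le_succ i)) (ZMod (l ^ i)) (s (i + 1)) = s i}
  mul_mem' {a b} ha hb i := by simp only [Pi.mul_apply, map_mul, ha i, hb i]
  one_mem' i := by simp only [Pi.one_apply, map_one]
  add_mem' {a b} ha hb i := by simp only [Pi.add_apply, map_add, ha i, hb i]
  zero_mem' i := by simp only [Pi.zero_apply, map_zero]
  neg_mem' {a} ha i := by simp only [Pi.neg_apply, map_neg, ha i]

omit [Fact l.Prime] in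
/-- Compatibility of a compatible sequence between arbitrary levels `k₁ ≤ k₂` (the inverse system of [NSW] (2.7.5)). [cite: NeukirchSchmidtWingberg2008, II §7 (2.7.5)] -/
theorem compatSeq_cast (s : compatSeq l) {k₁ k₂ : ℕ} (hk : k₁ ≤ k₂) :
    ZMod.castHom (pow_dvd_pow l hk) (ZMod (l ^ k₁)) (s.1 k₂) = s.1 k₁ := by
  induction hk with
  | refl => exact ZMod.cast_id _ _
  | @step k₂ hk ih =>
    rw [← ih, ← s.2 k₂]
    rw [← RingHom.comp_apply, ZMod.castHom_comp]

/-- The evaluations `compatSeq l →+* ℤ/lᵏ` (projections of the inverse system of [NSW] (2.7.5)). [cite: NeukirchSchmidtWingberg2008, II §7 (2.7.5)] -/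
def compatSeqEval (k : ℕ) : compatSeq l →+* ZMod (l ^ k) :=
  (Pi.evalRingHom (fun i : ℕ => ZMod (l ^ i)) k).comp (compatSeq l).subtype

omit [Fact l.Prime] in
/-- Compatibility of the evaluations, in the form required by `PadicInt.lift` (inverse system of [NSW] (2.7.5)). [cite: NeukirchSchmidtWingberg2008, II §7 (2.7.5)] -/
theorem compatSeqEval_compat (k₁ k₂ : ℕ) (hk : k₁ ≤ k₂) :
    (ZMod.castHom (pow_dvd_pow l hk) (ZMod (l ^ k₁))).comp (compatSeqEval l k₂) =
      compatSeqEval l k₁ :=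
  RingHom.ext fun s => compatSeq_cast l s hk

/-- **`ℤ_l` is presented by the tower `ℤ/lⁱ`**: the trivial representation `ℤ_l` of `G` as the inverse
limit of the trivial discrete representations `ℤ/lⁱ`, in the sense of the tree's
`DiscreteTowerPresentation`. [cite: NeukirchSchmidtWingberg2008, II §7 (2.7.5)] -/
def padicIntTower : DiscreteTowerPresentation (padicIntRep G l) where
  obj := zmodRep G l
  tr := zmodTr G l
  proj := padicProj G l
  tr_proj i x := by
    rw [zmodTr_hom_apply, padicProj_hom_apply, padicProj_hom_apply, ← RingHom.comp_apply,
      PadicInt.zmod_cast_comp_toZModPow i (i + 1) (Nat.le_succ i)]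
  discrete i := inferInstance
  continuous_action i := continuous_snd
  tr_surjective i := by
    intro x
    refine ⟨(x.val : ZMod (l ^ (i + 1))), ?_⟩
    rw [zmodTr_hom_apply, map_natCast, ZMod.natCast_zmod_val]
  proj_injective x y h := PadicInt.ext_of_toZModPow.mp fun i => h i
  proj_lift s hs := by
    let s' : compatSeq l := ⟨s, fun i => hs i⟩
    refine ⟨PadicInt.lift (compatSeqEval_compat l) s', fun i => ?_⟩
    rw [padicProj_hom_apply, ← RingHom.comp_apply, PadicInt.lift_spec]
    rfl
  isInducing := by
    have hc : Continuous fun (x : ℤ_[l]) (i : ℕ) => (padicProj G l i).hom x :=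
      continuous_pi fun i => OneUnits.continuous_toZModPow l i
    have hi : Injective fun (x : ℤ_[l]) (i : ℕ) => (padicProj G l i).hom x :=
      fun x y h => PadicInt.ext_of_toZModPow.mp fun i => congrFun h i
    exact (hc.isClosedEmbedding hi).isInducing

end Tower

/-! ### Uniform torsion of the `H²(G, ℤ/lⁱ)` kills `H²_cont(G, ℤ_l)` -/

section Torsion

variable {G : Type} [Group G] [TopologicalSpace G] [IsTopologicalGroup G] [LocallyCompactSpace G]
variable (l : ℕ) [Fact l.Prime]

/-- **If one integer `m` kills every `H²(G, ℤ/lⁱ)` and the `H¹(G, ℤ/lⁱ)` are finite, then `m` kills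
`H²_cont(G, ℤ_l)`** (injectivity of `H²(G, lim ℤ/lⁱ) → lim H²(G, ℤ/lⁱ)`, whose kernel is
`lim¹ H¹(G, ℤ/lⁱ) = 0`). [cite: NeukirchSchmidtWingberg2008, Cor (2.7.6)] -/
theorem nsmul_continuousCohomology_two_padicInt_eq_zero
    (hfin : ∀ i, Finite (continuousCohomology 1 (zmodRep G l i))) {m : ℕ}
    (hm : ∀ (i : ℕ) (x : continuousCohomology 2 (zmodRep G l i)), m • x = 0)
    (x : continuousCohomology 2 (padicIntRep G l)) : m • x = 0 := by
  apply (padicIntTower G l).toLimitClasses_injective hfin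
  rw [map_nsmul, map_zero]
  refine Subtype.ext (funext fun i => ?_)
  rw [AddSubmonoidClass.coe_nsmul, Pi.smul_apply,
    DiscreteTowerPresentation.toLimitClasses_apply_coe]
  exact hm i _

/-- Cocycle form: under the same hypotheses, `m` times every continuous `ℤ_l`-valued `2`-cocycle of
`G` (trivial action) is the coboundary of a continuous `ℤ_l`-valued `1`-cochain.
[cite: NeukirchSchmidtWingberg2008, Cor (2.7.6)] -/
theorem exists_padicInt_cochain_of_forall_zmod
    (hfin : ∀ i, Finite (continuousCohomology 1 (zmodRep G l i))) {m : ℕ}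
    (hm : ∀ (i : ℕ) (x : continuousCohomology 2 (zmodRep G l i)), m • x = 0)
    (z : contTwoCocycles (padicIntRep G l)) :
    ∃ b : C(G, ℤ_[l]), ∀ σ τ : G, (m : ℤ_[l]) * z.1 (σ, τ) = b τ - b (σ * τ) + b σ := by
  have h0 : twoCocycleClass (padicIntRep G l) ((m : ℤ) • z) = 0 := by
    rw [twoCocycleClass_smul, Nat.cast_smul_eq_nsmul]
    exact nsmul_continuousCohomology_two_padicInt_eq_zero l hfin hm _
  obtain ⟨b, hb⟩ := (twoCocycleClass_eq_zero_iff _ _).1 h0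
  refine ⟨b, fun σ τ => ?_⟩
  have h := hb σ τ
  change ((m : ℤ) • z.1) (σ, τ) = b τ - b (σ * τ) + b σ at h
  rw [ContinuousMap.smul_apply, zsmul_eq_mul, Int.cast_natCast] at h
  exact h

/-! ### Rational coefficients: `H²_cont(G, ℚ_l) = 0` -/

/-- **`H²_cont(G, ℚ_l) = 0` from uniform torsion at the finite levels.**  For a compact group `G`: if
one integer `m ≥ 1` kills `H²(G, ℤ/lⁱ)` for all `i` and the `H¹(G, ℤ/lⁱ)` are finite, then the second
continuous cohomology of the trivial representation `ℚ_l` (Mathlib's `continuousCohomology`, carrier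
`ULift ℚ_l` as in [AbsTopI] `δ²_l`) vanishes: a continuous `2`-cocycle `c` is bounded on the compact
`G × G`, `l^N c` is a `ℤ_l`-valued cocycle, `m l^N c = ∂b` with `b` continuous `ℤ_l`-valued, and
`c = ∂((m l^N)⁻¹ b)`. [cite: NeukirchSchmidtWingberg2008, Cor (2.7.6)]
[cite: MochizukiAbsTopI2012, Thm 2.6 (iii) proof p.23] -/
theorem subsingleton_continuousCohomology_two_padic_of_forall_zmod [CompactSpace G]
    (hfin : ∀ i, Finite (continuousCohomology 1 (zmodRep G l i))) {m : ℕ} (hm0 : 0 < m)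
    (hm : ∀ (i : ℕ) (x : continuousCohomology 2 (zmodRep G l i)), m • x = 0) :
    Subsingleton (continuousCohomology 2
      (TopRep.of (ContRepresentation.trivial ℚ_[l] G (ULift.{0} ℚ_[l])))) := by
  set X : TopRep.{0} ℚ_[l] G := TopRep.of (ContRepresentation.trivial ℚ_[l] G (ULift.{0} ℚ_[l]))
    with hX
  have hl1 : (1 : ℝ) < l := by exact_mod_cast (Fact.out : l.Prime).one_lt
  have hl0 : (0 : ℝ) < l := lt_trans zero_lt_one hl1
  refine ⟨fun x y => ?_⟩
  suffices h : ∀ x : continuousCohomology 2 X, x = 0 by rw [h x, h y]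
  intro x
  obtain ⟨c, rfl⟩ := twoCocycleClass_surjective X x
  -- the cocycle is bounded: `‖c‖ ≤ l^N`
  have hcont : Continuous fun p : G × G => (c.1 p).down := continuous_uliftDown.comp c.1.continuous
  obtain ⟨C, hC⟩ := (isCompact_univ (X := G × G)).bddAbove_image
    (continuous_norm.comp hcont).continuousOn
  have hC' : ∀ p : G × G, ‖(c.1 p).down‖ ≤ C := fun p =>
    hC (Set.mem_image_of_mem _ (Set.mem_univ p))
  obtain ⟨N, hN⟩ := pow_unbounded_of_one_lt C hl1
  -- `l^N c` is `ℤ_l`-valued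
  have hnorm : ∀ p : G × G, ‖(l : ℚ_[l]) ^ N * (c.1 p).down‖ ≤ 1 := fun p => by
    rw [norm_mul, norm_pow, Padic.norm_p]
    have h1 : ((l : ℝ)⁻¹) ^ N * ‖(c.1 p).down‖ ≤ ((l : ℝ)⁻¹) ^ N * (l : ℝ) ^ N :=
      mul_le_mul_of_nonneg_left ((hC' p).trans hN.le) (pow_nonneg (inv_nonneg.2 hl0.le) N)
    rw [inv_pow, inv_mul_cancel₀ (pow_ne_zero N hl0.ne')] at h1
    rw [inv_pow]
    exact h1
  let f : C(G × G, ℤ_[l]) :=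
    ⟨fun p => ⟨(l : ℚ_[l]) ^ N * (c.1 p).down, hnorm p⟩,
      (continuous_const.mul hcont).subtype_mk _⟩
  have hf : ∀ p : G × G, ((f p : ℤ_[l]) : ℚ_[l]) = (l : ℚ_[l]) ^ N * (c.1 p).down := fun _ => rfl
  have hfmem : f ∈ contTwoCocycles (padicIntRep G l) := by
    rw [mem_contTwoCocycles_iff]
    intro σ τ υ
    change f (τ, υ) + f (σ, τ * υ) = f (σ * τ, υ) + f (σ, τ)
    have h : (c.1 (τ, υ)).down + (c.1 (σ, τ * υ)).down = (c.1 (σ * τ, υ)).down + (c.1 (σ, τ)).down :=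
      congrArg ULift.down (c.2 σ τ υ)
    apply Subtype.ext
    push_cast
    rw [hf, hf, hf, hf, ← mul_add, ← mul_add, h]
  -- `m l^N c = ∂b`
  obtain ⟨b, hb⟩ := exists_padicInt_cochain_of_forall_zmod l hfin hm ⟨f, hfmem⟩
  rw [twoCocycleClass_eq_zero_iff]
  have hk : ((m : ℚ_[l]) * (l : ℚ_[l]) ^ N) ≠ 0 :=
    mul_ne_zero (by exact_mod_cast hm0.ne') (pow_ne_zero N (by exact_mod_cast (Fact.out : l.Prime).ne_zero))
  refine ⟨⟨fun σ => ULift.up (((m : ℚ_[l]) * (l : ℚ_[l]) ^ N)⁻¹ * ((b σ : ℤ_[l]) : ℚ_[l])),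
    continuous_uliftUp.comp (continuous_const.mul (continuous_subtype_val.comp b.continuous))⟩,
    fun σ τ => ?_⟩
  have h := congrArg (fun t : ℤ_[l] => (t : ℚ_[l])) (hb σ τ)
  simp only at h
  push_cast at h
  rw [hf] at h
  apply ULift.ext
  change (c.1 (σ, τ)).down =
    (((m : ℚ_[l]) * (l : ℚ_[l]) ^ N)⁻¹ * ((b τ : ℤ_[l]) : ℚ_[l])) -
      (((m : ℚ_[l]) * (l : ℚ_[l]) ^ N)⁻¹ * ((b (σ * τ) : ℤ_[l]) : ℚ_[l])) +
      (((m : ℚ_[l]) * (l : ℚ_[l]) ^ N)⁻¹ * ((b σ : ℤ_[l]) : ℚ_[l]))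
  rw [← mul_sub, ← mul_add, ← h, ← mul_assoc (m : ℚ_[l]) ((l : ℚ_[l]) ^ N), ← mul_assoc,
    inv_mul_cancel₀ hk, one_mul]

end Torsion

end Literature.NumberTheory.GaloisRepresentations

end
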